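import Summits.ABC.ABC.Theorems.PrimePowerRadical.Negative.Orders

/-!
# `PrimePowerRadical` (stmt-ABC-1648), line `Sketch`: Hensel uniqueness for the simple roots of `x^n − 1`

For a prime `p` and an exponent `n` with `p ∤ n`, two solutions of `x^n ≡ 1 (mod p²)` that agree modulo
`p` already agree modulo `p²`:

  `a^n ≡ 1 (mod p²)`, `b^n ≡ 1 (mod p²)`, `a ≡ b (mod p)` ⟹ `a ≡ b (mod p²)`.

(So the residues `a mod p²` with `a^{p−1} ≡ 1 (mod p²)` are the Teichmüller lifts, exactly ONE above each
nonzero residue mod `p` — the independence of "order mod `p`" and "Wieferich at `p`" used by the metric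
calibration of the open stub `stub_wdc` of the line.)

Proof (elementary, over `ℤ`): `b^n − a^n = S · (b − a)` with the geometric sum
`S = Σ_{i<n} b^i a^{n−1−i}` (`geom_sum₂_mul`). Both powers are `≡ 1 (mod p²)`, so `p² ∣ S · (b − a)`.
Since `p ∣ b − a`, `S ≡ n · b^{n−1} (mod p)`, and `p ∤ n`, `p ∤ b` (else `p ∣ b^n` and `p ∣ 1 − b^n` give
`p ∣ 1`; here `n ≥ 1` because `p ∣ 0`), hence `p ∤ S` (Mathlib's `not_dvd_geom_sum₂`). A prime power
dividing a product whose first factor is prime to `p` divides the second (`Prime.pow_dvd_of_dvd_mul_left`):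
`p² ∣ b − a`.

Sources: card `adelic-brjuno-summability` (crux stmt-ABC-1648, line `Sketch`, wave 2: the metric
calibration of the open stub `stub_wdc`). Mathlib only (`Nat.modEq_iff_dvd`, `not_dvd_geom_sum₂`,
`geom_sum₂_mul`, `Prime.pow_dvd_of_dvd_mul_left`, `Nat.prime_iff_prime_int`). Deliberately NOT here: the
existence half of Hensel's lemma, higher prime powers `p^k`, any counting of the roots of `x^n − 1`
modulo `p²` (that is the neighbouring stub `stub_card_roots_le`), and the other stubs of the line.
-/

noncomputable section

-- `Summit.<Summit>.<Problem>` is the mandated summit-side namespace (CONVENTIONS §2); for the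
-- single-conjunct summit `ABC` the two coincide, so the duplicate `ABC.ABC` is deliberate.
set_option linter.dupNamespace false

namespace Summit.ABC.ABC.Theorems.PrimePowerRadical.Brjuno

open Literature.NumberTheory.DiophantineGeometry UniqueFactorizationMonoid
open Summit.ABC.ABC.Theses.IneffectiveSubspace
open Summit.ABC.ABC.Theorems.PrimePowerRadical.Negative
open scoped BigOperators

/-- A natural-number congruence modulo `p ^ 2`, read as a divisibility over `ℤ`:
`x ≡ 1 [MOD p ^ 2]` gives `(p : ℤ) ^ 2 ∣ 1 − x`. -/
private theorem hen_sq_dvd_one_sub {p x : ℕ} (h : x ≡ 1 [MOD p ^ 2]) :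
    (p : ℤ) ^ 2 ∣ 1 - (x : ℤ) := by
  have h' := Nat.modEq_iff_dvd.mp h
  push_cast at h'
  exact h'

/-- If `b ^ n ≡ 1 [MOD p ^ 2]` with `n ≠ 0` and `p` prime, then `p ∤ b` (over `ℤ`). -/
private theorem hen_not_dvd_base {p n b : ℕ} (hpZ : Prime (p : ℤ)) (hn : n ≠ 0)
    (hb : (p : ℤ) ^ 2 ∣ 1 - (b : ℤ) ^ n) : ¬ (p : ℤ) ∣ (b : ℤ) := by
  intro h
  have h1 : (p : ℤ) ∣ (b : ℤ) ^ n := dvd_pow h hn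
  have h2 : (p : ℤ) ∣ 1 - (b : ℤ) ^ n := (dvd_pow_self (p : ℤ) two_ne_zero).trans hb
  have h3 : (p : ℤ) ∣ 1 := by simpa only [sub_add_cancel] using dvd_add h2 h1
  exact hpZ.not_dvd_one h3

/-- **Hensel uniqueness for the simple roots of `x^n − 1` modulo `p²`.** For a prime `p ∤ n`: if
`a^n ≡ 1` and `b^n ≡ 1 (mod p²)` and `a ≡ b (mod p)`, then `a ≡ b (mod p²)`. [folklore] -/
theorem stub_hensel_inj {p n a b : ℕ} (hp : p.Prime) (hpn : ¬ p ∣ n)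
    (ha : a ^ n ≡ 1 [MOD p ^ 2]) (hb : b ^ n ≡ 1 [MOD p ^ 2]) (hab : a ≡ b [MOD p]) :
    a ≡ b [MOD p ^ 2] := by
  have hpZ : Prime (p : ℤ) := Nat.prime_iff_prime_int.mp hp
  -- the hypotheses as divisibilities over `ℤ`
  have habZ : (p : ℤ) ∣ (b : ℤ) - (a : ℤ) := Nat.modEq_iff_dvd.mp hab
  have haZ : (p : ℤ) ^ 2 ∣ 1 - (a : ℤ) ^ n := by
    have h := hen_sq_dvd_one_sub ha
    push_cast at h
    exact h
  have hbZ : (p : ℤ) ^ 2 ∣ 1 - (b : ℤ) ^ n := by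
    have h := hen_sq_dvd_one_sub hb
    push_cast at h
    exact h
  have hnZ : ¬ (p : ℤ) ∣ (n : ℤ) := by rwa [Int.natCast_dvd_natCast]
  -- `n ≥ 1` (as `p ∣ 0`), so `p ∤ b`
  have hn0 : n ≠ 0 := by
    rintro rfl
    exact hpn (dvd_zero p)
  have hbp : ¬ (p : ℤ) ∣ (b : ℤ) := hen_not_dvd_base hpZ hn0 hbZ
  -- the geometric sum `S = Σ b^i a^{n-1-i}` is prime to `p` …
  have hS : ¬ (p : ℤ) ∣ ∑ i ∈ Finset.range n, (b : ℤ) ^ i * (a : ℤ) ^ (n - 1 - i) :=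
    not_dvd_geom_sum₂ hpZ habZ hbp hnZ
  -- … while `p² ∣ b^n − a^n = S · (b − a)`
  have hdiff : (p : ℤ) ^ 2 ∣
      (∑ i ∈ Finset.range n, (b : ℤ) ^ i * (a : ℤ) ^ (n - 1 - i)) * ((b : ℤ) - (a : ℤ)) := by
    rw [geom_sum₂_mul]
    have h := dvd_sub haZ hbZ
    rwa [sub_sub_sub_cancel_left] at h
  have hres : (p : ℤ) ^ 2 ∣ (b : ℤ) - (a : ℤ) := hpZ.pow_dvd_of_dvd_mul_left 2 hS hdiff
  exact Nat.modEq_iff_dvd.mpr (by exact_mod_cast hres)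

end Summit.ABC.ABC.Theorems.PrimePowerRadical.Brjuno

end
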